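import Literature.Computability.AlgebraicComplexity.BigCwSquareFamilyValue
import Literature.Computability.AlgebraicComplexity.LaserFormatPiece
import HarnessLib

/-!
# The laser pieces `[112]_σ`, `[121]_σ`, `[211]''` of `CW_q ⊗ CW_q` and the `3 : 3 : 2` family block

The three `𝒞`-tensor letters of the second power of the Coppersmith–Winograd tensor that enter
Le Gall's family (Le Gall 2012 §6.1, Table 2), packaged as `LaserPiece`s
(`LaserFormatPiece.lean`) so that blocks of ANY proportion `[112] : [121] : [211]` can be pooled
by iterating `LaserPiece.pair`:

* `piece112`: `T^{[112]}` with Coppersmith–Winograd's splitting `σ = a/n ∈ (0,1)` of its four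
  pair products (weight `σ/2` on the two `(1,q,q)`-products `T_{101}⊗T_{011}`, `T_{011}⊗T_{101}`,
  `(1−σ)/2` on the two `(q,1,1)`-products) — the data of `BigCwSquareFormatValue112`
  (marginal entropies `(1, 1, H₃(σ))`, formats `(q^{1−σ}, q^σ, q^σ)`,
  `H₃(σ) = (2η((1−σ)/2) + η(σ))/ln 2`);
* `piece121`: the same for `T^{[121]}` (products `T_{110}⊗T_{011}`, `T_{011}⊗T_{110}` of format
  `(q,q,1)` with weight `σ/2`, `T_{101}⊗T_{020}`, `T_{020}⊗T_{101}` of format `(1,1,q)` with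
  weight `(1−σ)/2`; entropies `(1, H₃(σ), 1)`, formats `(q^σ, q^σ, q^{1−σ})`) — its pair data
  `cwS121`, … is written out here (the tree had only the zero-out `[121]'`);
* `piece211r`: the zero-out `T^{[211]}''` of `T^{[211]}` to the `x`-pair-label `(1,1)` (the two
  `(q,1,q)`-products `T_{110}⊗T_{101}`, `T_{101}⊗T_{110}`, law `1/2, 1/2`; entropies `(0,1,1)`,
  formats `(q, 1, q)`) — Le Gall's splitting `b̃ = 1`.

For each piece the seven numbers `H₁, H₂, H₃, val, fmtA, fmtB, fmtC` are computed
(`piece112_H₁`, …), so that the value of a pooled block is read off by `simp` with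
`LaserPiece.pair_H₁` etc.  All component format values are `HasFormatValue.kronecker` of the
level-1 values `hasFormatValue_cwComp011/101/110/020/002/200`.

## The `3 : 3 : 2` family block (second half of the file)

Le Gall's optimal level-2 block for `k ≥ 2` is `[112]/[121]`-heavy with `b̃ = 1`; the second half
of this file pools

  `F = ([112]_σ ⊗ [121]_σ)^{⊗3} ⊗ [211]'' ⊗ [211]''`   (letters `3 : 3 : 2`),

bracketed `((P ⊗ P) ⊗ (P ⊗ (R ⊗ R)))`, `P = [112]_σ ⊗ [121]_σ`, `R = [211]''`, as ONE laser piece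
(`LaserPiece.pair` iterated three deep).  Pooled budgets `X = 6`, `Y = Z = 5 + 3H₃(σ)`, pooled
formats `(q^5, q^{6σ}, q^5)`; hence (`hasFormatValue_cwSqFamily332`) for every rational
`σ = a/n ∈ (0,1)` with `3H₃(σ) ≥ 1` the block is worth `2^6` independent products of format
`(q^5, q^{6σ}, q^5)`, and at `σ = 19/20` (`3H₃(19/20) ≥ 1` is the integer inequality
`2^20 · 19^57 ≤ 40^3 · 20^57`) the laser block of the 8-letter word `cwSqFam332Word` of
`(CW_q^{⊗2})^{⊗8}` is worth `(2^6; q^5, q^{57/10}, q^5)` (`hasFormatValue_laserBlock_cwSqFam332Word`)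
— the inner kernel of the level-2 rungs `ω(1,2,1) ≤ 101/31`, `ω(1,3,1) ≤ 80/19` of the
SaturationLadder (Le Gall 2012 Table 2 has `ω(1,1,2) < 3.256689` at level 2).

References: D. Coppersmith, S. Winograd, *Matrix multiplication via arithmetic progressions*,
J. Symb. Comput. 9 (1990), §8 [CoppersmithWinograd1990]; F. Le Gall, *Faster algorithms for
rectangular matrix multiplication*, FOCS 2012, arXiv:1204.1111, §6.1 [LeGall2012]; F. Le Gall,
*Powers of tensors and fast matrix multiplication*, ISSAC 2014, §5 [LeGall2014]; D. Coppersmith,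
*Rectangular matrix multiplication revisited*, J. Complexity 13 (1997), §3 [Coppersmith1997].
-/

set_option autoImplicit false
set_option linter.style.longLine false
set_option linter.unusedSectionVars false
set_option linter.unusedVariables false

noncomputable section

open Finset Real
open scoped BigOperators

universe u

namespace Literature.Computability.AlgebraicComplexity

open Literature.Barriers.MatrixMultiplication

/-! ## Small entropy evaluations -/

section Entropy

/-- Entropy of a law `1/2, 1/2` on two labels of `PL` (given as an `if`-chain): `1` bit.
[cite: CoppersmithWinograd1990, §8] -/
private theorem shannonEntropy_two_halves' (u w : PL) (huw : u ≠ w) :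
    shannonEntropy (fun x : PL => if x = u then (1 : ℝ) / 2 else if x = w then 1 / 2 else 0) = 1 := by
  have hl : Real.log 2 ≠ 0 := (Real.log_pos one_lt_two).ne'
  rw [shannonEntropy_def]
  have hsum : ∑ x : PL, negMulLog (if x = u then (1 : ℝ) / 2 else if x = w then 1 / 2 else 0) =
      negMulLog (1 / 2) + negMulLog (1 / 2) := by
    rw [← Finset.sum_subset (Finset.subset_univ ({u, w} : Finset PL)) (fun x _ hx => by
      simp only [Finset.mem_insert, Finset.mem_singleton, not_or] at hx
      simp [hx.1, hx.2])]
    rw [Finset.sum_insert (by simpa using huw), Finset.sum_singleton]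
    simp [huw.symm]
  rw [hsum]
  simp [Real.negMulLog, Real.log_inv]
  field_simp
  norm_num

/-- Entropy of a point mass on `PL` (given as an `if`): `0`. [cite: CoppersmithWinograd1990, §8] -/
private theorem shannonEntropy_dirac' (u : PL) :
    shannonEntropy (fun x : PL => if x = u then (1 : ℝ) else 0) = 0 := by
  rw [shannonEntropy_def]
  have hsum : ∑ x : PL, negMulLog (if x = u then (1 : ℝ) else 0) = 0 := by
    refine Finset.sum_eq_zero fun x _ => ?_
    split_ifs <;> simp
  rw [hsum, zero_div]

end Entropy

/-! ## The piece `[112]_σ` -/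

section Piece112

variable (K : Type u) [Field K] (q : ℕ)

/-- The values of the format data of `[112]` on the four pairs. [cite: Coppersmith1997, §3] -/
private theorem cwF112_values' :
    cwF112A q ((1, 0), (1, 0), (0, 2)) = q ∧ cwF112A q ((0, 1), (0, 1), (2, 0)) = q ∧
    cwF112A q ((1, 0), (0, 1), (1, 1)) = 1 ∧ cwF112A q ((0, 1), (1, 0), (1, 1)) = 1 ∧
    cwF112B q ((1, 0), (1, 0), (0, 2)) = 1 ∧ cwF112B q ((0, 1), (0, 1), (2, 0)) = 1 ∧
    cwF112B q ((1, 0), (0, 1), (1, 1)) = q ∧ cwF112B q ((0, 1), (1, 0), (1, 1)) = q := by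
  refine ⟨?_, ?_, ?_, ?_, ?_, ?_, ?_, ?_⟩ <;> simp [cwF112A, cwF112B]

/-- `cwF112A > 0` for `q ≥ 1`. [cite: Coppersmith1997, §3] -/
private theorem cwF112A_pos' (hq : 1 ≤ q) (s : PL × PL × PL) : 0 < cwF112A q s := by
  have : (0 : ℝ) < q := by exact_mod_cast hq
  simp only [cwF112A]; split_ifs <;> positivity

/-- `cwF112B > 0` for `q ≥ 1`. [cite: Coppersmith1997, §3] -/
private theorem cwF112B_pos' (hq : 1 ≤ q) (s : PL × PL × PL) : 0 < cwF112B q s := by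
  have : (0 : ℝ) < q := by exact_mod_cast hq
  simp only [cwF112B]; split_ifs <;> positivity

/-- The four counts of the splitting `σ = a/n`. [cite: CoppersmithWinograd1990, §8] -/
private theorem cwC112_values' (a n : ℕ) :
    cwC112 a n ((1, 0), (1, 0), (0, 2)) = n - a ∧ cwC112 a n ((0, 1), (0, 1), (2, 0)) = n - a ∧
    cwC112 a n ((1, 0), (0, 1), (1, 1)) = a ∧ cwC112 a n ((0, 1), (1, 0), (1, 1)) = a := by
  refine ⟨?_, ?_, ?_, ?_⟩ <;> simp [cwC112, cwS112]

/-- `cwC112` vanishes off `cwS112`. [cite: CoppersmithWinograd1990, §8] -/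
private theorem cwC112_eq_zero' (a n : ℕ) (s : PL × PL × PL) (hs : s ∉ cwS112) : cwC112 a n s = 0 := by
  simp [cwC112, hs]

/-- `∑ cwC112 a n = 2n` (for `a ≤ n`). [cite: CoppersmithWinograd1990, §8] -/
private theorem sum_cwC112' {a n : ℕ} (han : a ≤ n) : ∑ s, cwC112 a n s = 2 * n := by
  rw [← Finset.sum_subset (Finset.subset_univ cwS112) (fun s _ hs => cwC112_eq_zero' a n s hs)]
  obtain ⟨e1, e2, e3, e4⟩ := cwC112_values' a n
  simp only [cwS112]
  rw [Finset.sum_insert (by decide), Finset.sum_insert (by decide), Finset.sum_insert (by decide),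
    Finset.sum_singleton, e1, e2, e3, e4]
  omega

/-- `cwP112 (a/n) = cwC112 a n / (2n)`. [cite: CoppersmithWinograd1990, §8] -/
private theorem cwP112_eq_cwC112_div' {a n : ℕ} (han : a ≤ n) (hn : 0 < n) {σ : ℝ}
    (hσ : σ = (a : ℝ) / n) (s : PL × PL × PL) :
    cwP112 σ s = (cwC112 a n s : ℝ) / ((2 * n : ℕ) : ℝ) := by
  have hn0 : (n : ℝ) ≠ 0 := by exact_mod_cast hn.ne'
  by_cases hs : s ∈ cwS112
  · simp only [cwP112, cwC112, if_pos hs]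
    split_ifs
    · rw [hσ]; push_cast; field_simp
    · rw [hσ]; push_cast [Nat.cast_sub han]; field_simp
  · simp [cwP112, cwC112, hs]

/-- **The laser piece `[112]_σ`**: Coppersmith–Winograd's pair decomposition of `T^{[112]}` with
the rational splitting `σ = a/n ∈ (0,1)` (law `cwP112 σ = cwC112 a n/(2n)`, product form
`1 · 1 · h(z)`), component formats `(cwF112A, cwF112B, cwF112B)`.
[cite: CoppersmithWinograd1990, §8] [cite: Coppersmith1997, §3] [cite: LeGall2012, §6.1] -/
def piece112 (hq : 1 ≤ q) {a n : ℕ} (ha : 0 < a) (han : a < n) {σ : ℝ} (hσ : σ = (a : ℝ) / n) :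
    LaserPiece K (cwSqComp K q 1 1 2) cwPairLev cwPairLev cwPairLev :=
  have hn : 0 < n := lt_of_le_of_lt (Nat.zero_le a) han
  have hn0 : (0 : ℝ) < n := by exact_mod_cast hn
  have h0 : 0 < σ := by rw [hσ]; positivity
  have h1 : σ < 1 := by rw [hσ, div_lt_one hn0]; exact_mod_cast han
  { S := cwS112
    hS := cwSqComp112_support K q
    r := 2
    b := 2
    α := cwTight112
    β := cwTight112
    γ := cwTight112γ
    hα := cwTight112_injective
    hβ := cwTight112_injective
    hγ := cwTight112γ_injective
    hαb := cwTight112_bound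
    hβb := cwTight112_bound
    htight := cwTight112_sum
    v := fun _ => 1
    fA := cwF112A q
    fB := cwF112B q
    fC := cwF112B q
    hv := fun _ _ => one_pos
    hfA := fun s _ => cwF112A_pos' q hq s
    hfB := fun s _ => cwF112B_pos' q hq s
    hfC := fun s _ => cwF112B_pos' q hq s
    hval := fun s hs => hasFormatValue_cwS112 K q s hs
    c := cwC112 a n
    hcS := cwC112_eq_zero' a n
    d := 2 * n
    hd := by omega
    hc := sum_cwC112' han.le
    P := cwP112 σ
    hP := cwP112_eq_cwC112_div' han.le hn hσ
    f := fun _ => 1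
    g := fun _ => 1
    h := fun z => if z = (1, 1) then σ / 2 else (1 - σ) / 2
    hf := fun _ _ => one_pos
    hg := fun _ _ => one_pos
    hh := fun s _ => by split_ifs <;> linarith
    hprod := fun s hs => by simp only [cwP112, if_pos hs, one_mul] }

variable {K q}

/-- `H₁([112]_σ) = 1`. [cite: CoppersmithWinograd1990, §8] -/
theorem piece112_H₁ (hq : 1 ≤ q) {a n : ℕ} (ha : 0 < a) (han : a < n) {σ : ℝ}
    (hσ : σ = (a : ℝ) / n) : (piece112 K q hq ha han hσ).H₁ = 1 :=
  shannonEntropy_marginalDist₁_cwP112 σ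

/-- `H₂([112]_σ) = 1`. [cite: CoppersmithWinograd1990, §8] -/
theorem piece112_H₂ (hq : 1 ≤ q) {a n : ℕ} (ha : 0 < a) (han : a < n) {σ : ℝ}
    (hσ : σ = (a : ℝ) / n) : (piece112 K q hq ha han hσ).H₂ = 1 :=
  shannonEntropy_marginalDist₂_cwP112 σ

/-- `H₃([112]_σ) = H₃(σ) = (2η((1−σ)/2) + η(σ))/ln 2`. [cite: CoppersmithWinograd1990, §8] -/
theorem piece112_H₃ (hq : 1 ≤ q) {a n : ℕ} (ha : 0 < a) (han : a < n) {σ : ℝ}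
    (hσ : σ = (a : ℝ) / n) :
    (piece112 K q hq ha han hσ).H₃ = (2 * negMulLog ((1 - σ) / 2) + negMulLog σ) / Real.log 2 :=
  shannonEntropy_marginalDist₃_cwP112 σ

/-- `val([112]_σ) = 1` (one product per pair component). [cite: Coppersmith1997, §3] -/
theorem piece112_val (hq : 1 ≤ q) {a n : ℕ} (ha : 0 < a) (han : a < n) {σ : ℝ}
    (hσ : σ = (a : ℝ) / n) : (piece112 K q hq ha han hσ).val = 1 :=
  Finset.prod_eq_one fun s _ => Real.one_rpow _

/-- `fmtA([112]_σ) = q^{1−σ}`. [cite: Coppersmith1997, §3] [cite: LeGall2012, §6.1] -/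
theorem piece112_fmtA (hq : 1 ≤ q) {a n : ℕ} (ha : 0 < a) (han : a < n) {σ : ℝ}
    (hσ : σ = (a : ℝ) / n) : (piece112 K q hq ha han hσ).fmtA = (q : ℝ) ^ (1 - σ) := by
  have hq0 : (0 : ℝ) < (q : ℕ) := by exact_mod_cast hq
  obtain ⟨e1, e2, e3, e4⟩ := cwP112_values σ
  obtain ⟨a1, a2, a3, a4, b1, b2, b3, b4⟩ := cwF112_values' q
  show ∏ s ∈ cwS112, cwF112A q s ^ cwP112 σ s = (q : ℝ) ^ (1 - σ)
  simp only [cwS112]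
  rw [Finset.prod_insert (by decide), Finset.prod_insert (by decide),
    Finset.prod_insert (by decide), Finset.prod_singleton, e1, e2, e3, e4, a1, a2, a3, a4]
  simp only [Real.one_rpow, mul_one]
  rw [← Real.rpow_add hq0]
  ring_nf

/-- `fmtB([112]_σ) = q^{σ}`. [cite: Coppersmith1997, §3] [cite: LeGall2012, §6.1] -/
theorem piece112_fmtB (hq : 1 ≤ q) {a n : ℕ} (ha : 0 < a) (han : a < n) {σ : ℝ}
    (hσ : σ = (a : ℝ) / n) : (piece112 K q hq ha han hσ).fmtB = (q : ℝ) ^ σ := by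
  have hq0 : (0 : ℝ) < (q : ℕ) := by exact_mod_cast hq
  obtain ⟨e1, e2, e3, e4⟩ := cwP112_values σ
  obtain ⟨a1, a2, a3, a4, b1, b2, b3, b4⟩ := cwF112_values' q
  show ∏ s ∈ cwS112, cwF112B q s ^ cwP112 σ s = (q : ℝ) ^ σ
  simp only [cwS112]
  rw [Finset.prod_insert (by decide), Finset.prod_insert (by decide),
    Finset.prod_insert (by decide), Finset.prod_singleton, e1, e2, e3, e4, b1, b2, b3, b4]
  simp only [Real.one_rpow, one_mul]
  rw [← Real.rpow_add hq0]
  ring_nf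

/-- `fmtC([112]_σ) = q^{σ}`. [cite: Coppersmith1997, §3] [cite: LeGall2012, §6.1] -/
theorem piece112_fmtC (hq : 1 ≤ q) {a n : ℕ} (ha : 0 < a) (han : a < n) {σ : ℝ}
    (hσ : σ = (a : ℝ) / n) : (piece112 K q hq ha han hσ).fmtC = (q : ℝ) ^ σ :=
  piece112_fmtB hq ha han hσ

end Piece112

/-! ## The pair data of `T^{[121]}` and the piece `[121]_σ` -/

section Piece121

/-- **The support of the pair decomposition of `T^{[121]}`**: the four pairs
`(101,020), (020,101), (110,011), (011,110)` by coordinates `((i,i'),(j,j'),(l,l'))`.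
[cite: CoppersmithWinograd1990, §8] [cite: LeGall2012, §6.1] -/
def cwS121 : Finset (PL × PL × PL) :=
  {((1, 0), (0, 2), (1, 0)), ((0, 1), (2, 0), (0, 1)), ((1, 0), (1, 1), (0, 1)), ((0, 1), (1, 1), (1, 0))}

/-- The tightness relation on `cwS121`. [cite: LeGall2014, §5] -/
theorem cwTight121_sum (s : PL × PL × PL) (hs : s ∈ cwS121) (k : Fin 2) :
    cwTight112 s.1 k + cwTight112 s.2.1 k + cwTight112γ s.2.2 k = 0 := by
  simp only [cwS121, Finset.mem_insert, Finset.mem_singleton] at hs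
  rcases hs with rfl | rfl | rfl | rfl <;> fin_cases k <;> simp [cwTight112, cwTight112γ]

variable (K : Type u) [Field K] (q : ℕ)

/-- **The pair labels of the support of `T^{[121]}` lie in `cwS121`.** [cite: CoppersmithWinograd1990, §8] -/
theorem cwSqComp121_support (x y z : Fin (q + 2) × Fin (q + 2)) (h : cwSqComp K q 1 2 1 x y z ≠ 0) :
    (cwPairLev x, cwPairLev y, cwPairLev z) ∈ cwS121 := by
  obtain ⟨ex, ey, ez, h1, h2⟩ := cwSqComp_levels K q h
  simp only [Fin.isValue, Fin.val_two, Fin.val_one] at ex ey ez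
  have by1 := cwLevel_le_two y.1; have by2 := cwLevel_le_two y.2
  simp only [cwS121, Finset.mem_insert, Finset.mem_singleton, Prod.mk.injEq, cwPairLev, Fin.ext_iff,
    cwLevel₃_val, Fin.isValue, Fin.val_zero, Fin.val_one, Fin.val_two]
  omega

/-- First (= second) format of the pair components of `[121]`: `q` on the two `(q,q,1)`-products
(`y`-pair-label `(1,1)`: `T_{110}⊗T_{011}`, `T_{011}⊗T_{110}`), `1` on the two `(1,1,q)`-products
(`T_{101}⊗T_{020}`, `T_{020}⊗T_{101}`). [cite: CoppersmithWinograd1990, §8] [cite: Coppersmith1997, §3] -/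
def cwF121A (s : PL × PL × PL) : ℝ := if s.2.1 = (1, 1) then (q : ℝ) else 1

/-- Third format of the pair components of `[121]`: `1` resp. `q`. [cite: CoppersmithWinograd1990, §8]
[cite: Coppersmith1997, §3] -/
def cwF121C (s : PL × PL × PL) : ℝ := if s.2.1 = (1, 1) then 1 else (q : ℝ)

/-- The values of the format data on the four pairs. [cite: Coppersmith1997, §3] -/
private theorem cwF121_values :
    cwF121A q ((1, 0), (0, 2), (1, 0)) = 1 ∧ cwF121A q ((0, 1), (2, 0), (0, 1)) = 1 ∧
    cwF121A q ((1, 0), (1, 1), (0, 1)) = q ∧ cwF121A q ((0, 1), (1, 1), (1, 0)) = q ∧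
    cwF121C q ((1, 0), (0, 2), (1, 0)) = q ∧ cwF121C q ((0, 1), (2, 0), (0, 1)) = q ∧
    cwF121C q ((1, 0), (1, 1), (0, 1)) = 1 ∧ cwF121C q ((0, 1), (1, 1), (1, 0)) = 1 := by
  refine ⟨?_, ?_, ?_, ?_, ?_, ?_, ?_, ?_⟩ <;> simp [cwF121A, cwF121C]

/-- `cwF121A > 0` (for `q ≥ 1`). [cite: Coppersmith1997, §3] -/
private theorem cwF121A_pos (hq : 1 ≤ q) (s : PL × PL × PL) : 0 < cwF121A q s := by
  have : (0 : ℝ) < q := by exact_mod_cast hq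
  simp only [cwF121A]; split_ifs <;> positivity

/-- `cwF121C > 0` (for `q ≥ 1`). [cite: Coppersmith1997, §3] -/
private theorem cwF121C_pos (hq : 1 ≤ q) (s : PL × PL × PL) : 0 < cwF121C q s := by
  have : (0 : ℝ) < q := by exact_mod_cast hq
  simp only [cwF121C]; split_ifs <;> positivity

/-- **The format values of the four products of `[121]`** (`cwSqComp_pair` and the level-1
formats): format `(cwF121A, cwF121A, cwF121C)`, one product each. [cite: CoppersmithWinograd1990, §8]
[cite: Coppersmith1997, §3] -/
theorem hasFormatValue_cwS121 (s : PL × PL × PL) (hs : s ∈ cwS121) :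
    HasFormatValue (partSubtensor cwPairLev cwPairLev cwPairLev (cwSqComp K q 1 2 1)
      {s.1} {s.2.1} {s.2.2}) 1 (cwF121A q s) (cwF121A q s) (cwF121C q s) := by
  have hq0 : (0 : ℝ) ≤ q := Nat.cast_nonneg q
  obtain ⟨a1, a2, a3, a4, c1, c2, c3, c4⟩ := cwF121_values q
  simp only [cwS121, Finset.mem_insert, Finset.mem_singleton] at hs
  rcases hs with rfl | rfl | rfl | rfl
  · rw [a1, c1, cwSqComp_pair, if_pos (by refine ⟨?_, ?_, ?_⟩ <;> ext <;> simp)]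
    have h := (hasFormatValue_cwComp101 K q).kronecker (hasFormatValue_cwComp020 K q) zero_le_one
      zero_le_one zero_le_one zero_le_one zero_le_one zero_le_one hq0 zero_le_one
    simpa using h
  · rw [a2, c2, cwSqComp_pair, if_pos (by refine ⟨?_, ?_, ?_⟩ <;> ext <;> simp)]
    have h := (hasFormatValue_cwComp020 K q).kronecker (hasFormatValue_cwComp101 K q) zero_le_one
      zero_le_one zero_le_one zero_le_one zero_le_one zero_le_one zero_le_one hq0
    simpa using h
  · rw [a3, c3, cwSqComp_pair, if_pos (by refine ⟨?_, ?_, ?_⟩ <;> ext <;> simp)]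
    have h := (hasFormatValue_cwComp110 K q).kronecker (hasFormatValue_cwComp011 K q) zero_le_one
      zero_le_one hq0 zero_le_one zero_le_one hq0 zero_le_one zero_le_one
    simpa using h
  · rw [a4, c4, cwSqComp_pair, if_pos (by refine ⟨?_, ?_, ?_⟩ <;> ext <;> simp)]
    have h := (hasFormatValue_cwComp011 K q).kronecker (hasFormatValue_cwComp110 K q) zero_le_one
      zero_le_one zero_le_one hq0 hq0 zero_le_one zero_le_one zero_le_one
    simpa using h

/-- **The counts of the splitting `σ = a/n` of `[121]`**: `a` on each `(q,q,1)`-product, `n − a` on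
each `(1,1,q)`-product (denominator `2n`). [cite: CoppersmithWinograd1990, §8] [cite: LeGall2012, §6.1] -/
def cwC121 (a n : ℕ) (s : PL × PL × PL) : ℕ :=
  if s ∈ cwS121 then (if s.2.1 = (1, 1) then a else n - a) else 0

/-- The four counts. [cite: CoppersmithWinograd1990, §8] -/
private theorem cwC121_values (a n : ℕ) :
    cwC121 a n ((1, 0), (0, 2), (1, 0)) = n - a ∧ cwC121 a n ((0, 1), (2, 0), (0, 1)) = n - a ∧
    cwC121 a n ((1, 0), (1, 1), (0, 1)) = a ∧ cwC121 a n ((0, 1), (1, 1), (1, 0)) = a := by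
  refine ⟨?_, ?_, ?_, ?_⟩ <;> simp [cwC121, cwS121]

/-- `cwC121` vanishes off `cwS121`. [cite: CoppersmithWinograd1990, §8] -/
private theorem cwC121_eq_zero (a n : ℕ) (s : PL × PL × PL) (hs : s ∉ cwS121) : cwC121 a n s = 0 := by
  simp [cwC121, hs]

/-- `∑ cwC121 a n = 2n` (for `a ≤ n`). [cite: CoppersmithWinograd1990, §8] -/
private theorem sum_cwC121 {a n : ℕ} (han : a ≤ n) : ∑ s, cwC121 a n s = 2 * n := by
  rw [← Finset.sum_subset (Finset.subset_univ cwS121) (fun s _ hs => cwC121_eq_zero a n s hs)]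
  obtain ⟨e1, e2, e3, e4⟩ := cwC121_values a n
  simp only [cwS121]
  rw [Finset.sum_insert (by decide), Finset.sum_insert (by decide), Finset.sum_insert (by decide),
    Finset.sum_singleton, e1, e2, e3, e4]
  omega

/-- **The law of the splitting of `[121]`**: `σ/2` on each `(q,q,1)`-product, `(1−σ)/2` on each
`(1,1,q)`-product. [cite: CoppersmithWinograd1990, §8] [cite: LeGall2012, §6.1] -/
def cwP121 (σ : ℝ) (s : PL × PL × PL) : ℝ :=
  if s ∈ cwS121 then (if s.2.1 = (1, 1) then σ / 2 else (1 - σ) / 2) else 0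

/-- The four values of the law. [cite: CoppersmithWinograd1990, §8] -/
private theorem cwP121_values (σ : ℝ) :
    cwP121 σ ((1, 0), (0, 2), (1, 0)) = (1 - σ) / 2 ∧ cwP121 σ ((0, 1), (2, 0), (0, 1)) = (1 - σ) / 2 ∧
    cwP121 σ ((1, 0), (1, 1), (0, 1)) = σ / 2 ∧ cwP121 σ ((0, 1), (1, 1), (1, 0)) = σ / 2 := by
  refine ⟨?_, ?_, ?_, ?_⟩ <;> simp [cwP121, cwS121]

/-- `cwP121 σ` vanishes off `cwS121`. [cite: CoppersmithWinograd1990, §8] -/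
private theorem cwP121_eq_zero (σ : ℝ) (s : PL × PL × PL) (hs : s ∉ cwS121) : cwP121 σ s = 0 := by
  simp [cwP121, hs]

/-- `cwP121 (a/n) = cwC121 a n / (2n)`. [cite: CoppersmithWinograd1990, §8] -/
private theorem cwP121_eq_cwC121_div {a n : ℕ} (han : a ≤ n) (hn : 0 < n) {σ : ℝ}
    (hσ : σ = (a : ℝ) / n) (s : PL × PL × PL) :
    cwP121 σ s = (cwC121 a n s : ℝ) / ((2 * n : ℕ) : ℝ) := by
  have hn0 : (n : ℝ) ≠ 0 := by exact_mod_cast hn.ne'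
  by_cases hs : s ∈ cwS121
  · simp only [cwP121, cwC121, if_pos hs]
    split_ifs
    · rw [hσ]; push_cast; field_simp
    · rw [hσ]; push_cast [Nat.cast_sub han]; field_simp
  · simp [cwP121, cwC121, hs]

/-- The `x`-marginal of `[121]_σ`: `(1,0), (0,1) ↦ 1/2`. [cite: CoppersmithWinograd1990, §8] -/
theorem marginalDist₁_cwP121 (σ : ℝ) : marginalDist₁ (cwP121 σ) = fun x =>
    if x = (1, 0) then 1 / 2 else if x = (0, 1) then 1 / 2 else 0 := by
  obtain ⟨e1, e2, e3, e4⟩ := cwP121_values σ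
  funext x
  rw [marginalDist₁_eq_sum_filter cwS121 (cwP121_eq_zero σ)]
  obtain ⟨a, b⟩ := x
  fin_cases a <;> fin_cases b <;>
    simp [cwS121, Finset.filter_insert, Finset.filter_singleton, e1, e2, e3, e4] <;> ring

/-- The `y`-marginal of `[121]_σ`: `(0,2), (2,0) ↦ (1−σ)/2`, `(1,1) ↦ σ`. [cite: CoppersmithWinograd1990, §8] -/
theorem marginalDist₂_cwP121 (σ : ℝ) : marginalDist₂ (cwP121 σ) = fun y =>
    if y = (0, 2) then (1 - σ) / 2 else if y = (2, 0) then (1 - σ) / 2 else if y = (1, 1) then σ else 0 := by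
  obtain ⟨e1, e2, e3, e4⟩ := cwP121_values σ
  funext y
  rw [marginalDist₂_eq_sum_filter cwS121 (cwP121_eq_zero σ)]
  obtain ⟨a, b⟩ := y
  fin_cases a <;> fin_cases b <;>
    simp [cwS121, Finset.filter_insert, Finset.filter_singleton, e1, e2, e3, e4]

/-- The `z`-marginal of `[121]_σ`: `(1,0), (0,1) ↦ 1/2`. [cite: CoppersmithWinograd1990, §8] -/
theorem marginalDist₃_cwP121 (σ : ℝ) : marginalDist₃ (cwP121 σ) = fun z =>
    if z = (1, 0) then 1 / 2 else if z = (0, 1) then 1 / 2 else 0 := by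
  obtain ⟨e1, e2, e3, e4⟩ := cwP121_values σ
  funext z
  rw [marginalDist₃_eq_sum_filter cwS121 (cwP121_eq_zero σ)]
  obtain ⟨a, b⟩ := z
  fin_cases a <;> fin_cases b <;>
    simp [cwS121, Finset.filter_insert, Finset.filter_singleton, e1, e2, e3, e4] <;> ring

/-- **The laser piece `[121]_σ`** (law `cwP121 σ = cwC121 a n/(2n)`, product form `1 · g(y) · 1`,
component formats `(cwF121A, cwF121A, cwF121C)`). [cite: CoppersmithWinograd1990, §8]
[cite: Coppersmith1997, §3] [cite: LeGall2012, §6.1] -/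
def piece121 (hq : 1 ≤ q) {a n : ℕ} (ha : 0 < a) (han : a < n) {σ : ℝ} (hσ : σ = (a : ℝ) / n) :
    LaserPiece K (cwSqComp K q 1 2 1) cwPairLev cwPairLev cwPairLev :=
  have hn : 0 < n := lt_of_le_of_lt (Nat.zero_le a) han
  have hn0 : (0 : ℝ) < n := by exact_mod_cast hn
  have h0 : 0 < σ := by rw [hσ]; positivity
  have h1 : σ < 1 := by rw [hσ, div_lt_one hn0]; exact_mod_cast han
  { S := cwS121
    hS := cwSqComp121_support K q
    r := 2
    b := 2
    α := cwTight112
    β := cwTight112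
    γ := cwTight112γ
    hα := cwTight112_injective
    hβ := cwTight112_injective
    hγ := cwTight112γ_injective
    hαb := cwTight112_bound
    hβb := cwTight112_bound
    htight := cwTight121_sum
    v := fun _ => 1
    fA := cwF121A q
    fB := cwF121A q
    fC := cwF121C q
    hv := fun _ _ => one_pos
    hfA := fun s _ => cwF121A_pos q hq s
    hfB := fun s _ => cwF121A_pos q hq s
    hfC := fun s _ => cwF121C_pos q hq s
    hval := fun s hs => hasFormatValue_cwS121 K q s hs
    c := cwC121 a n
    hcS := cwC121_eq_zero a n
    d := 2 * n
    hd := by omega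
    hc := sum_cwC121 han.le
    P := cwP121 σ
    hP := cwP121_eq_cwC121_div han.le hn hσ
    f := fun _ => 1
    g := fun y => if y = (1, 1) then σ / 2 else (1 - σ) / 2
    h := fun _ => 1
    hf := fun _ _ => one_pos
    hg := fun s _ => by split_ifs <;> linarith
    hh := fun _ _ => one_pos
    hprod := fun s hs => by simp only [cwP121, if_pos hs, one_mul, mul_one] }

variable {K q}

/-- `H₁([121]_σ) = 1`. [cite: CoppersmithWinograd1990, §8] -/
theorem piece121_H₁ (hq : 1 ≤ q) {a n : ℕ} (ha : 0 < a) (han : a < n) {σ : ℝ}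
    (hσ : σ = (a : ℝ) / n) : (piece121 K q hq ha han hσ).H₁ = 1 := by
  show shannonEntropy (marginalDist₁ (cwP121 σ)) = 1
  rw [marginalDist₁_cwP121]; exact shannonEntropy_two_halves' _ _ (by decide)

/-- `H₂([121]_σ) = H₃(σ)`. [cite: CoppersmithWinograd1990, §8] -/
theorem piece121_H₂ (hq : 1 ≤ q) {a n : ℕ} (ha : 0 < a) (han : a < n) {σ : ℝ}
    (hσ : σ = (a : ℝ) / n) :
    (piece121 K q hq ha han hσ).H₂ = (2 * negMulLog ((1 - σ) / 2) + negMulLog σ) / Real.log 2 := by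
  show shannonEntropy (marginalDist₂ (cwP121 σ)) = _
  rw [marginalDist₂_cwP121, shannonEntropy_def, Fintype.sum_prod_type]
  simp only [Fin.sum_univ_three]
  simp
  ring

/-- `H₃([121]_σ) = 1`. [cite: CoppersmithWinograd1990, §8] -/
theorem piece121_H₃ (hq : 1 ≤ q) {a n : ℕ} (ha : 0 < a) (han : a < n) {σ : ℝ}
    (hσ : σ = (a : ℝ) / n) : (piece121 K q hq ha han hσ).H₃ = 1 := by
  show shannonEntropy (marginalDist₃ (cwP121 σ)) = 1
  rw [marginalDist₃_cwP121]; exact shannonEntropy_two_halves' _ _ (by decide)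

/-- `val([121]_σ) = 1`. [cite: Coppersmith1997, §3] -/
theorem piece121_val (hq : 1 ≤ q) {a n : ℕ} (ha : 0 < a) (han : a < n) {σ : ℝ}
    (hσ : σ = (a : ℝ) / n) : (piece121 K q hq ha han hσ).val = 1 :=
  Finset.prod_eq_one fun s _ => Real.one_rpow _

/-- `fmtA([121]_σ) = q^{σ}`. [cite: Coppersmith1997, §3] [cite: LeGall2012, §6.1] -/
theorem piece121_fmtA (hq : 1 ≤ q) {a n : ℕ} (ha : 0 < a) (han : a < n) {σ : ℝ}
    (hσ : σ = (a : ℝ) / n) : (piece121 K q hq ha han hσ).fmtA = (q : ℝ) ^ σ := by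
  have hq0 : (0 : ℝ) < (q : ℕ) := by exact_mod_cast hq
  obtain ⟨e1, e2, e3, e4⟩ := cwP121_values σ
  obtain ⟨a1, a2, a3, a4, c1, c2, c3, c4⟩ := cwF121_values q
  show ∏ s ∈ cwS121, cwF121A q s ^ cwP121 σ s = (q : ℝ) ^ σ
  simp only [cwS121]
  rw [Finset.prod_insert (by decide), Finset.prod_insert (by decide),
    Finset.prod_insert (by decide), Finset.prod_singleton, e1, e2, e3, e4, a1, a2, a3, a4]
  simp only [Real.one_rpow, one_mul]
  rw [← Real.rpow_add hq0]
  ring_nf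

/-- `fmtB([121]_σ) = q^{σ}`. [cite: Coppersmith1997, §3] [cite: LeGall2012, §6.1] -/
theorem piece121_fmtB (hq : 1 ≤ q) {a n : ℕ} (ha : 0 < a) (han : a < n) {σ : ℝ}
    (hσ : σ = (a : ℝ) / n) : (piece121 K q hq ha han hσ).fmtB = (q : ℝ) ^ σ :=
  piece121_fmtA hq ha han hσ

/-- `fmtC([121]_σ) = q^{1−σ}`. [cite: Coppersmith1997, §3] [cite: LeGall2012, §6.1] -/
theorem piece121_fmtC (hq : 1 ≤ q) {a n : ℕ} (ha : 0 < a) (han : a < n) {σ : ℝ}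
    (hσ : σ = (a : ℝ) / n) : (piece121 K q hq ha han hσ).fmtC = (q : ℝ) ^ (1 - σ) := by
  have hq0 : (0 : ℝ) < (q : ℕ) := by exact_mod_cast hq
  obtain ⟨e1, e2, e3, e4⟩ := cwP121_values σ
  obtain ⟨a1, a2, a3, a4, c1, c2, c3, c4⟩ := cwF121_values q
  show ∏ s ∈ cwS121, cwF121C q s ^ cwP121 σ s = (q : ℝ) ^ (1 - σ)
  simp only [cwS121]
  rw [Finset.prod_insert (by decide), Finset.prod_insert (by decide),
    Finset.prod_insert (by decide), Finset.prod_singleton, e1, e2, e3, e4, c1, c2, c3, c4]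
  simp only [Real.one_rpow, mul_one]
  rw [← Real.rpow_add hq0]
  ring_nf

end Piece121

/-! ## The zero-out `T^{[211]}''` and the piece `[211]''` -/

section Piece211r

variable (K : Type u) [Field K] (q : ℕ)

/-- **`T^{[211]}''`**: the zero-out of `T^{[211]}` to the `x`-pair-label `(1,1)` (the two products
`T_{110}⊗T_{101}`, `T_{101}⊗T_{110}` of format `(q,1,q)`; the `(1,q,1)`-products are dropped —
the splitting `b̃ = 1` of Le Gall 2012 §6.1). [cite: LeGall2012, §6.1] [cite: CoppersmithWinograd1990, §8] -/
def cwSqComp211r : Fin (q + 2) × Fin (q + 2) → Fin (q + 2) × Fin (q + 2) → Fin (q + 2) × Fin (q + 2) → K :=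
  partSubtensor cwPairLev cwPairLev cwPairLev (cwSqComp K q 2 1 1) {((1 : Fin 3), (1 : Fin 3))}
    Finset.univ Finset.univ

/-- `T^{[211]} ≥ T^{[211]}''` (zero-out). [cite: LeGall2012, §6.1] -/
theorem tensorRestrictsTo_cwSqComp211r : TensorRestrictsTo (cwSqComp K q 2 1 1) (cwSqComp211r K q) :=
  tensorRestrictsTo_partSubtensor _ _ _ _ _ _ _

/-- The two pair components of `T^{[211]}''`. [cite: CoppersmithWinograd1990, §8] -/
def cwS211r : Finset (PL × PL × PL) := {((1, 1), (1, 0), (0, 1)), ((1, 1), (0, 1), (1, 0))}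

/-- Tightness on `cwS211r`. [cite: LeGall2014, §5] -/
theorem cwTight211r_sum (s : PL × PL × PL) (hs : s ∈ cwS211r) (k : Fin 2) :
    cwTight112 s.1 k + cwTight112 s.2.1 k + cwTight112γ s.2.2 k = 0 := by
  simp only [cwS211r, Finset.mem_insert, Finset.mem_singleton] at hs
  rcases hs with rfl | rfl <;> fin_cases k <;> simp [cwTight112, cwTight112γ]

/-- **The pair labels of the support of `T^{[211]}''` lie in `cwS211r`.** [cite: CoppersmithWinograd1990, §8] -/
theorem cwSqComp211r_support (x y z : Fin (q + 2) × Fin (q + 2)) (h : cwSqComp211r K q x y z ≠ 0) :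
    (cwPairLev x, cwPairLev y, cwPairLev z) ∈ cwS211r := by
  rw [cwSqComp211r, partSubtensor_apply] at h
  split_ifs at h with hc
  · obtain ⟨hx, -, -⟩ := hc
    rw [Finset.mem_singleton] at hx
    obtain ⟨ex, ey, ez, h1, h2⟩ := cwSqComp_levels K q h
    simp only [Fin.isValue, Fin.val_two, Fin.val_one] at ex ey ez
    have hx' := hx
    simp only [cwPairLev, Prod.mk.injEq, Fin.ext_iff, cwLevel₃_val, Fin.isValue, Fin.val_one] at hx'
    have by1 := cwLevel_le_two y.1; have by2 := cwLevel_le_two y.2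
    simp only [cwS211r, Finset.mem_insert, Finset.mem_singleton, Prod.mk.injEq, cwPairLev, Fin.ext_iff,
      cwLevel₃_val, Fin.isValue, Fin.val_zero, Fin.val_one]
    omega
  · exact absurd rfl h

/-- The pair blocks of `T^{[211]}''` are pair blocks of `T^{[211]}`. [cite: LeGall2012, §6.1] -/
private theorem cwSqComp211r_block (s : PL × PL × PL) (hs : s ∈ cwS211r) :
    partSubtensor cwPairLev cwPairLev cwPairLev (cwSqComp211r K q) {s.1} {s.2.1} {s.2.2} =
      partSubtensor cwPairLev cwPairLev cwPairLev (cwSqComp K q 2 1 1) {s.1} {s.2.1} {s.2.2} := by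
  have hx : s.1 = ((1 : Fin 3), (1 : Fin 3)) := by
    simp only [cwS211r, Finset.mem_insert, Finset.mem_singleton] at hs
    rcases hs with rfl | rfl <;> rfl
  rw [cwSqComp211r, partSubtensor_partSubtensor, Finset.univ_inter, Finset.univ_inter, ← hx,
    Finset.inter_self]

/-- **The two products of `T^{[211]}''` have format `(q,1,q)`** (`T_{110}⊗T_{101}`, `T_{101}⊗T_{110}`).
[cite: CoppersmithWinograd1990, §8] [cite: LeGall2012, §6.1] -/
theorem hasFormatValue_cwS211r (s : PL × PL × PL) (hs : s ∈ cwS211r) :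
    HasFormatValue (partSubtensor cwPairLev cwPairLev cwPairLev (cwSqComp211r K q)
      {s.1} {s.2.1} {s.2.2}) ((fun _ : PL × PL × PL => (1 : ℝ)) s)
      ((fun _ : PL × PL × PL => (q : ℝ)) s) ((fun _ : PL × PL × PL => (1 : ℝ)) s)
      ((fun _ : PL × PL × PL => (q : ℝ)) s) := by
  have hq0 : (0 : ℝ) ≤ q := Nat.cast_nonneg q
  rw [cwSqComp211r_block K q s hs]
  simp only [cwS211r, Finset.mem_insert, Finset.mem_singleton] at hs
  rcases hs with rfl | rfl
  · rw [cwSqComp_pair, if_pos (by refine ⟨?_, ?_, ?_⟩ <;> ext <;> simp)]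
    have h := (hasFormatValue_cwComp110 K q).kronecker (hasFormatValue_cwComp101 K q) zero_le_one
      zero_le_one hq0 zero_le_one zero_le_one zero_le_one zero_le_one hq0
    simpa using h
  · rw [cwSqComp_pair, if_pos (by refine ⟨?_, ?_, ?_⟩ <;> ext <;> simp)]
    have h := (hasFormatValue_cwComp101 K q).kronecker (hasFormatValue_cwComp110 K q) zero_le_one
      zero_le_one zero_le_one hq0 zero_le_one zero_le_one hq0 zero_le_one
    simpa using h

/-- `cwC2r S` vanishes off `S`. [cite: LeGall2012, §6.1] -/
private theorem cwC2r_eq_zero' (S : Finset (PL × PL × PL)) (s : PL × PL × PL) (hs : s ∉ S) :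
    cwC2r S s = 0 := by
  simp [cwC2r, hs]

/-- `cwP2r S = cwC2r S / 2`. [cite: LeGall2012, §6.1] -/
private theorem cwP2r_eq_cwC2_div' (S : Finset (PL × PL × PL)) (s : PL × PL × PL) :
    cwP2r S s = (cwC2r S s : ℝ) / ((2 : ℕ) : ℝ) := by
  by_cases hs : s ∈ S <;> simp [cwP2r, cwC2r, hs]

/-- `∑ cwC2r cwS211r = 2`. [cite: LeGall2012, §6.1] -/
private theorem sum_cwC2_cwS211r : ∑ s, cwC2r cwS211r s = 2 := by
  rw [← Finset.sum_subset (Finset.subset_univ cwS211r) (fun s _ hs => cwC2r_eq_zero' cwS211r s hs)]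
  simp only [cwS211r]
  rw [Finset.sum_insert (by decide), Finset.sum_singleton]
  simp [cwC2r]

/-- `cwP2r cwS211r` vanishes off `cwS211r`. [cite: LeGall2012, §6.1] -/
private theorem cwP2r_cwS211r_eq_zero (s : PL × PL × PL) (hs : s ∉ cwS211r) : cwP2r cwS211r s = 0 := by
  simp [cwP2r, hs]

/-- The `x`-marginal of the law of `T^{[211]}''`: `(1,1) ↦ 1`. [cite: CoppersmithWinograd1990, §8] -/
theorem marginalDist₁_cwP2_cwS211r : marginalDist₁ (cwP2r cwS211r) = fun x =>
    if x = (1, 1) then 1 else 0 := by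
  funext x
  rw [marginalDist₁_eq_sum_filter cwS211r cwP2r_cwS211r_eq_zero]
  obtain ⟨a, b⟩ := x
  fin_cases a <;> fin_cases b <;>
    norm_num [cwS211r, cwP2r, Finset.filter_insert, Finset.filter_singleton]

/-- `y`: `(1,0), (0,1) ↦ 1/2`. [cite: CoppersmithWinograd1990, §8] -/
theorem marginalDist₂_cwP2_cwS211r : marginalDist₂ (cwP2r cwS211r) = fun y =>
    if y = (1, 0) then 1 / 2 else if y = (0, 1) then 1 / 2 else 0 := by
  funext y
  rw [marginalDist₂_eq_sum_filter cwS211r cwP2r_cwS211r_eq_zero]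
  obtain ⟨a, b⟩ := y
  fin_cases a <;> fin_cases b <;>
    simp [cwS211r, cwP2r, Finset.filter_insert, Finset.filter_singleton]

/-- `z`: `(0,1), (1,0) ↦ 1/2`. [cite: CoppersmithWinograd1990, §8] -/
theorem marginalDist₃_cwP2_cwS211r : marginalDist₃ (cwP2r cwS211r) = fun z =>
    if z = (0, 1) then 1 / 2 else if z = (1, 0) then 1 / 2 else 0 := by
  funext z
  rw [marginalDist₃_eq_sum_filter cwS211r cwP2r_cwS211r_eq_zero]
  obtain ⟨a, b⟩ := z
  fin_cases a <;> fin_cases b <;>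
    simp [cwS211r, cwP2r, Finset.filter_insert, Finset.filter_singleton]

/-- **The laser piece `[211]''`** (two products, law `1/2, 1/2`, product form `1/2 · 1 · 1`,
formats `(q,1,q)`). [cite: LeGall2012, §6.1] [cite: CoppersmithWinograd1990, §8] [cite: Coppersmith1997, §3] -/
def piece211r (hq : 1 ≤ q) : LaserPiece K (cwSqComp211r K q) cwPairLev cwPairLev cwPairLev :=
  have hq0 : (0 : ℝ) < (q : ℝ) := by exact_mod_cast hq
  { S := cwS211r
    hS := cwSqComp211r_support K q
    r := 2
    b := 2
    α := cwTight112
    β := cwTight112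
    γ := cwTight112γ
    hα := cwTight112_injective
    hβ := cwTight112_injective
    hγ := cwTight112γ_injective
    hαb := cwTight112_bound
    hβb := cwTight112_bound
    htight := cwTight211r_sum
    v := fun _ => 1
    fA := fun _ => (q : ℝ)
    fB := fun _ => 1
    fC := fun _ => (q : ℝ)
    hv := fun _ _ => one_pos
    hfA := fun _ _ => hq0
    hfB := fun _ _ => one_pos
    hfC := fun _ _ => hq0
    hval := fun s hs => hasFormatValue_cwS211r K q s hs
    c := cwC2r cwS211r
    hcS := cwC2r_eq_zero' cwS211r
    d := 2
    hd := by norm_num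
    hc := sum_cwC2_cwS211r
    P := cwP2r cwS211r
    hP := cwP2r_eq_cwC2_div' cwS211r
    f := fun _ => 1 / 2
    g := fun _ => 1
    h := fun _ => 1
    hf := fun _ _ => by norm_num
    hg := fun _ _ => one_pos
    hh := fun _ _ => one_pos
    hprod := cwP2r_prod cwS211r }

variable {K q}

/-- `H₁([211]'') = 0`. [cite: LeGall2012, §6.1] -/
theorem piece211r_H₁ (hq : 1 ≤ q) : (piece211r K q hq).H₁ = 0 := by
  show shannonEntropy (marginalDist₁ (cwP2r cwS211r)) = 0
  rw [marginalDist₁_cwP2_cwS211r]; exact shannonEntropy_dirac' _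

/-- `H₂([211]'') = 1`. [cite: LeGall2012, §6.1] -/
theorem piece211r_H₂ (hq : 1 ≤ q) : (piece211r K q hq).H₂ = 1 := by
  show shannonEntropy (marginalDist₂ (cwP2r cwS211r)) = 1
  rw [marginalDist₂_cwP2_cwS211r]; exact shannonEntropy_two_halves' _ _ (by decide)

/-- `H₃([211]'') = 1`. [cite: LeGall2012, §6.1] -/
theorem piece211r_H₃ (hq : 1 ≤ q) : (piece211r K q hq).H₃ = 1 := by
  show shannonEntropy (marginalDist₃ (cwP2r cwS211r)) = 1
  rw [marginalDist₃_cwP2_cwS211r]; exact shannonEntropy_two_halves' _ _ (by decide)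

/-- Mass one of the law of `[211]''` over its support. [cite: LeGall2012, §6.1] -/
private theorem sum_cwP2r_cwS211r : ∑ s ∈ cwS211r, cwP2r cwS211r s = 1 :=
  (law_sum_eq_one' (cwC2r_eq_zero' cwS211r) (by norm_num) sum_cwC2_cwS211r
    (cwP2r_eq_cwC2_div' cwS211r)).2

/-- `val([211]'') = 1`. [cite: LeGall2012, §6.1] -/
theorem piece211r_val (hq : 1 ≤ q) : (piece211r K q hq).val = 1 :=
  Finset.prod_eq_one fun s _ => Real.one_rpow _

/-- `fmtA([211]'') = q`. [cite: LeGall2012, §6.1] -/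
theorem piece211r_fmtA (hq : 1 ≤ q) : (piece211r K q hq).fmtA = q := by
  have hq0 : (0 : ℝ) < q := by exact_mod_cast hq
  show ∏ s ∈ cwS211r, (q : ℝ) ^ cwP2r cwS211r s = q
  rw [← Real.rpow_sum_of_pos hq0, sum_cwP2r_cwS211r, Real.rpow_one]

/-- `fmtB([211]'') = 1`. [cite: LeGall2012, §6.1] -/
theorem piece211r_fmtB (hq : 1 ≤ q) : (piece211r K q hq).fmtB = 1 :=
  Finset.prod_eq_one fun s _ => Real.one_rpow _

/-- `fmtC([211]'') = q`. [cite: LeGall2012, §6.1] -/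
theorem piece211r_fmtC (hq : 1 ≤ q) : (piece211r K q hq).fmtC = q :=
  piece211r_fmtA hq

end Piece211r

/-! ## The pooled `3 : 3 : 2` piece `F = ([112]_σ ⊗ [121]_σ)^{⊗3} ⊗ [211]''^{⊗2}` -/

section Family332

variable (K : Type u) [Field K] (q : ℕ)

/-- `P = T^{[112]} ⊗ T^{[121]}`. [cite: LeGall2012, §6.1] -/
abbrev cwSqPair12 := kroneckerTensor (cwSqComp K q 1 1 2) (cwSqComp K q 1 2 1)

/-- **The `3 : 3 : 2` family tensor** `F = ((P ⊗ P) ⊗ (P ⊗ (R ⊗ R)))`, `P = [112] ⊗ [121]`,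
`R = [211]''`. [cite: LeGall2012, §6.1 and Prop. 6.2] -/
abbrev cwSqFamily332 :=
  kroneckerTensor (kroneckerTensor (cwSqPair12 K q) (cwSqPair12 K q))
    (kroneckerTensor (cwSqPair12 K q) (kroneckerTensor (cwSqComp211r K q) (cwSqComp211r K q)))

/-- **Le Gall 2012 §6.1 / Prop. 6.2 in format currency for the `3 : 3 : 2` block.**  For `q ≥ 1`
and a rational splitting `σ = a/n ∈ (0,1)` of `[112]`, `[121]` with `3H₃(σ) ≥ 1`
(`H₃(σ) = (2η((1−σ)/2) + η(σ))/ln 2`), the family tensor `F` is worth `2^6` independent products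
of format `(q^5, q^{6σ}, q^5)`: one laser piece, pooled budgets `X = 6 ≤ Y = Z = 5 + 3H₃(σ)`,
all laws of product form (`Γ = 0`). [cite: LeGall2012, §6.1 and Prop. 6.2]
[cite: CoppersmithWinograd1990, §8] [cite: Coppersmith1997, §3] [cite: LeGall2014, Thm. 4.1 and §5] -/
theorem hasFormatValue_cwSqFamily332 (hq : 1 ≤ q) {a n : ℕ} (ha : 0 < a) (han : a < n) {σ : ℝ}
    (hσ : σ = (a : ℝ) / n)
    (hcap : 1 ≤ 3 * ((2 * negMulLog ((1 - σ) / 2) + negMulLog σ) / Real.log 2)) :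
    HasFormatValue (cwSqFamily332 K q) ((2 : ℝ) ^ (6 : ℝ)) ((q : ℝ) ^ (5 : ℝ))
      ((q : ℝ) ^ (6 * σ)) ((q : ℝ) ^ (5 : ℝ)) := by
  have hq0 : (0 : ℝ) < (q : ℝ) := by exact_mod_cast hq
  set H : ℝ := (2 * negMulLog ((1 - σ) / 2) + negMulLog σ) / Real.log 2 with hH
  have key := ((((piece112 K q hq ha han hσ).pair (piece121 K q hq ha han hσ)).pair
    ((piece112 K q hq ha han hσ).pair (piece121 K q hq ha han hσ))).pair
    (((piece112 K q hq ha han hσ).pair (piece121 K q hq ha han hσ)).pair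
      ((piece211r K q hq).pair (piece211r K q hq)))).hasFormatValue
  simp only [LaserPiece.pair_H₁, LaserPiece.pair_H₂, LaserPiece.pair_H₃, LaserPiece.pair_val,
    LaserPiece.pair_fmtA, LaserPiece.pair_fmtB, LaserPiece.pair_fmtC, piece112_H₁, piece112_H₂,
    piece112_H₃, piece112_val, piece112_fmtA, piece112_fmtB, piece112_fmtC, piece121_H₁,
    piece121_H₂, piece121_H₃, piece121_val, piece121_fmtA, piece121_fmtB, piece121_fmtC,
    piece211r_H₁, piece211r_H₂, piece211r_H₃, piece211r_val, piece211r_fmtA, piece211r_fmtB,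
    piece211r_fmtC, mul_one, add_zero, ← hH] at key
  -- the pooled budgets: `X = 6`, `Y = Z = 5 + 3H ≥ 6`
  have hmin : min ((1 : ℝ) + 1 + (1 + 1) + (1 + 1)) (min (1 + H + (1 + H) + (1 + H + (1 + 1)))
      (H + 1 + (H + 1) + (H + 1 + (1 + 1)))) = 6 := by
    rw [min_eq_left_iff.mpr]
    · norm_num
    · rw [le_min_iff]; constructor <;> linarith
  rw [hmin] at key
  have e₁ : (q : ℝ) ^ (1 - σ) * (q : ℝ) ^ σ = q := by
    rw [← Real.rpow_add hq0, show (1 : ℝ) - σ + σ = 1 by ring, Real.rpow_one]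
  have e₃ : (q : ℝ) ^ σ * (q : ℝ) ^ (1 - σ) = q := by
    rw [← Real.rpow_add hq0, show σ + ((1 : ℝ) - σ) = 1 by ring, Real.rpow_one]
  have e5 : (q : ℝ) ^ (5 : ℝ) = q * q * (q * (q * q)) := by
    rw [show (5 : ℝ) = ((5 : ℕ) : ℝ) by norm_num, Real.rpow_natCast]; ring
  convert key using 2
  · rw [e₁, e5]
  · simp only [← Real.rpow_add hq0]
    ring_nf
  · rw [e₃, e5]

end Family332

/-! ## The family word and its laser block -/

section FamilyWord

variable (K : Type u) [Field K] (q : ℕ)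

/-- A one-letter word. [cite: LeGall2014, Appendix A.3] -/
private def w1 (s : Fin 5 × Fin 5 × Fin 5) : Fin 1 → Fin 5 × Fin 5 × Fin 5 := fun _ => s

/-- The word `((1,1,2), (1,2,1))` of the pair `P`. [cite: LeGall2012, §6.1] -/
def cwSqPair12Word : Fin (1 + 1) → Fin 5 × Fin 5 × Fin 5 :=
  Fin.append (fun _ : Fin 1 => ((1 : Fin 5), (1 : Fin 5), (2 : Fin 5)))
    (fun _ : Fin 1 => ((1 : Fin 5), (2 : Fin 5), (1 : Fin 5)))

/-- **The `3 : 3 : 2` family word** `((112,121),(112,121)),((112,121),(211,211))` (8 letters of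
`CW_q^{⊗2}`, bracketed as the Kronecker product `F`). [cite: LeGall2012, §6.1] -/
def cwSqFam332Word : Fin (1 + 1 + (1 + 1) + (1 + 1 + (1 + 1))) → Fin 5 × Fin 5 × Fin 5 :=
  Fin.append (Fin.append cwSqPair12Word cwSqPair12Word)
    (Fin.append cwSqPair12Word
      (Fin.append (fun _ : Fin 1 => ((2 : Fin 5), (1 : Fin 5), (1 : Fin 5)))
        (fun _ : Fin 1 => ((2 : Fin 5), (1 : Fin 5), (1 : Fin 5)))))

/-- The letters of the family word. [cite: LeGall2012, §6.1] -/
theorem cwSqFam332Word_mem (ρ : Fin (1 + 1 + (1 + 1) + (1 + 1 + (1 + 1)))) :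
    cwSqFam332Word ρ ∈ ({((1 : Fin 5), (1 : Fin 5), (2 : Fin 5)), (1, 2, 1), (2, 1, 1)} :
      Finset (Fin 5 × Fin 5 × Fin 5)) := by
  revert ρ
  decide

/-- The letter counts of the family word: `3, 3, 2`. [cite: LeGall2012, §6.1] -/
theorem letterCount_cwSqFam332Word (s : Fin 5 × Fin 5 × Fin 5) :
    letterCount cwSqFam332Word s =
      (if s = (1, 1, 2) then 3 else 0) + (if s = (1, 2, 1) then 3 else 0) +
        (if s = (2, 1, 1) then 2 else 0) := by
  simp only [cwSqFam332Word, cwSqPair12Word, letterCount_append, Pi.add_apply, letterCount_one]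
  split_ifs <;> omega

/-- The laser block of the pair word restricts to `P = T^{[112]} ⊗ T^{[121]}`.
[cite: LeGall2012, §6.1] [cite: LeGall2014, Appendix A.3] -/
theorem tensorRestrictsTo_laserBlock_cwSqPair12Word :
    TensorRestrictsTo (laserBlock cwLev2 cwLev2 cwLev2 (bigCwSq K q) cwSqPair12Word)
      (cwSqPair12 K q) :=
  (tensorRestrictsTo_laserBlock_append _ _ _ _ _ _).trans (TensorRestrictsTo.kronecker
    (tensorRestrictsTo_laserBlock_one _ _ _ _ _) (tensorRestrictsTo_laserBlock_one _ _ _ _ _))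

/-- **The laser block of the family word restricts to the family tensor**
`(CW_q^{⊗2})^{⊗8}(cwSqFam332Word) ≥ F` (block of a concatenation ⊇ Kronecker product of blocks;
one-letter blocks are the components; then the zero-outs `[211] ≥ [211]''`).
[cite: LeGall2012, §6.1] [cite: LeGall2014, Appendix A.3] -/
theorem tensorRestrictsTo_laserBlock_cwSqFam332Word :
    TensorRestrictsTo (laserBlock cwLev2 cwLev2 cwLev2 (bigCwSq K q) cwSqFam332Word)
      (cwSqFamily332 K q) := by
  refine (tensorRestrictsTo_laserBlock_append _ _ _ _ _ _).trans (TensorRestrictsTo.kronecker ?_ ?_)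
  · exact (tensorRestrictsTo_laserBlock_append _ _ _ _ _ _).trans (TensorRestrictsTo.kronecker
      (tensorRestrictsTo_laserBlock_cwSqPair12Word K q) (tensorRestrictsTo_laserBlock_cwSqPair12Word K q))
  · refine (tensorRestrictsTo_laserBlock_append _ _ _ _ _ _).trans (TensorRestrictsTo.kronecker
      (tensorRestrictsTo_laserBlock_cwSqPair12Word K q) ?_)
    exact (tensorRestrictsTo_laserBlock_append _ _ _ _ _ _).trans (TensorRestrictsTo.kronecker
      ((tensorRestrictsTo_laserBlock_one _ _ _ _ _).trans (tensorRestrictsTo_cwSqComp211r K q))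
      ((tensorRestrictsTo_laserBlock_one _ _ _ _ _).trans (tensorRestrictsTo_cwSqComp211r K q)))

/-- **`3H₃(19/20) ≥ 1`**: the integer certificate `2^20 · 19^57 ≤ 40^3 · 20^57` of
`3(2η(1/40) + η(19/20)) ≥ ln 2`. [cite: LeGall2012, Table 2] -/
theorem three_H3_nineteen_twentieths :
    1 ≤ 3 * ((2 * negMulLog ((1 - (19 / 20 : ℝ)) / 2) + negMulLog (19 / 20 : ℝ)) / Real.log 2) := by
  have hl2 : 0 < Real.log 2 := Real.log_pos one_lt_two
  have cert : (2 : ℝ) ^ 20 * 19 ^ 57 ≤ 40 ^ 3 * 20 ^ 57 := by norm_num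
  have hlog := Real.log_le_log (by positivity) cert
  rw [Real.log_mul (by positivity) (by positivity), Real.log_mul (by positivity) (by positivity),
    Real.log_pow, Real.log_pow, Real.log_pow, Real.log_pow] at hlog
  simp only [Nat.cast_ofNat] at hlog
  have e1 : negMulLog ((1 - (19 / 20 : ℝ)) / 2) = (1 / 40) * Real.log 40 := by
    rw [show (1 - (19 / 20 : ℝ)) / 2 = (40 : ℝ)⁻¹ by norm_num, Real.negMulLog, Real.log_inv]; ring
  have e2 : negMulLog (19 / 20 : ℝ) = (19 / 20) * (Real.log 20 - Real.log 19) := by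
    rw [Real.negMulLog, Real.log_div (by norm_num) (by norm_num)]; ring
  rw [e1, e2, ← mul_div_assoc, le_div_iff₀ hl2]
  linarith

/-- **The format value of the `3 : 3 : 2` family block** (Le Gall 2012 Prop. 6.2 / Table 2, format
currency, splitting `σ = 19/20`, `b̃ = 1`): the laser block `(CW_q^{⊗2})^{⊗8}(cwSqFam332Word)` is worth
`2^6` independent products of format `(q^5, q^{57/10}, q^5)`. [cite: LeGall2012, §6.1 and Prop. 6.2]
[cite: CoppersmithWinograd1990, §8] [cite: Coppersmith1997, §3] -/
theorem hasFormatValue_laserBlock_cwSqFam332Word (hq : 1 ≤ q) :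
    HasFormatValue (laserBlock cwLev2 cwLev2 cwLev2 (bigCwSq K q) cwSqFam332Word)
      ((2 : ℝ) ^ (6 : ℝ)) ((q : ℝ) ^ (5 : ℝ)) ((q : ℝ) ^ (57 / 10 : ℝ)) ((q : ℝ) ^ (5 : ℝ)) := by
  have h := hasFormatValue_cwSqFamily332 K q hq (a := 19) (n := 20) (by norm_num) (by norm_num)
    (σ := 19 / 20) (by norm_num) three_H3_nineteen_twentieths
  rw [show (6 : ℝ) * (19 / 20) = 57 / 10 by norm_num] at h
  exact HasFormatValue.of_restrictsTo (tensorRestrictsTo_laserBlock_cwSqFam332Word K q) h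

end FamilyWord

end Literature.Computability.AlgebraicComplexity

end
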